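import Summits.Ventures.PercRepro.C041TriDomAnchoredZMerge
import Summits.Ventures.PercRepro.C041TriDomAnchoredConeFour

/-!
# ROW C-041 — THE x-SPLIT ON FOUR-MARK PATTERNS: the patterns of the contraction of an edge at the anchor's
double-component are the `x`–`q` joins of the deletion's four-mark patterns (p6, gen 49)

For a free edge `f = pq` with `p` in the double-component of the anchor `x = a₁`, the contraction of `f` joins the
blocks of `x` and of `q` in both colours.  On the four-mark patterns `(xy, xz, xq, yz, yq, zq)` of `(x, y, z, q)`
(`rsig6` / `bsig6` of `C041TriDomExcessFour`, with `q = u''`) this is the join `xjoin6`; its projection to the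
three marks is `xjoin3` (the analogue of `zmerge3` of `C041TriDomAnchoredZMerge` with the anchor in place of `z`).
`rsig6_double_xjoin6` / `bsig6_double_xjoin6` express the four-mark patterns of the contraction through the
deletion's; `rsig_double_xjoin3` / `bsig_double_xjoin3` the three-mark ones.  These are the pattern lemmas of any
certificate for a statement split at an edge of the anchor's component whose induction hypotheses are four-mark
functionals (THEOREM (THE ANCHORED CONE, FOUR MARKS)) at the deletion and at the contraction.
-/

namespace PercRepro

namespace ZoneZ

namespace MultiExit

open ZoneData Finset

variable {V₁ E₁ U₁ U₂ : Type} (Z₁ : ZoneData V₁ E₁ U₁ U₂) (u u' a₁ : V₁)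

/-! ## The joins on patterns -/

/-- The four-mark pattern `(xy, xz, xq, yz, yq, zq)` after joining the blocks of `x` and `q`. -/
def xjoin6 (s : P6) : P6 :=
  (s.1 || s.2.2.2.2.1, s.2.1 || s.2.2.2.2.2, true, s.2.2.2.1 || (s.1 && s.2.2.2.2.2) || (s.2.2.2.2.1 && s.2.1),
    s.1 || s.2.2.2.2.1, s.2.1 || s.2.2.2.2.2)

/-- The three-mark pattern after joining the blocks of `x` and `q`. -/
def xjoin3 (s : P6) : P3 :=
  (s.1 || s.2.2.2.2.1, s.2.1 || s.2.2.2.2.2, s.2.2.2.1 || (s.1 && s.2.2.2.2.2) || (s.2.2.2.2.1 && s.2.1))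

/-- The three-mark projection of the four-mark join is the three-mark join. -/
theorem proj3_xjoin6 (s : P6) : proj3 (xjoin6 s) = xjoin3 s := rfl

/-- The join is a refinement of the pattern. -/
theorem le6_xjoin6 : ∀ s : P6, Le6 s (xjoin6 s) := by decide

/-- The join is an x-merge (two non-anchor marks are joined only through the anchor). -/
theorem xmerge6_xjoin6 : ∀ s : P6, XMerge6 s (xjoin6 s) := by decide

/-- The join of a transitive pattern is transitive. -/
theorem trans6_xjoin6 : ∀ s : P6, Trans6 s → Trans6 (xjoin6 s) := by decide

/-! ## The patterns of the contraction of an edge at the double-component of the anchor -/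

variable [DecidableEq E₁]

/-- With `p` in the double-component of `x`, the contraction of `f = pq` joins the blocks of `x` and `q` (red). -/
theorem RdS_double_iff_xq {st : E₁ → EStat} {f : E₁} (hf : st f = .free) (ω : E₁ → Bool) {p q : V₁}
    (hj : Z₁.Joins f p q) (hp : p ∈ dblCompS Z₁ st a₁) (a b : V₁) :
    RdS Z₁ (Function.update st f .double) ω a b ↔
      RdS Z₁ (Function.update st f .absent) ω a b ∨
        (RdS Z₁ (Function.update st f .absent) ω a a₁ ∧ RdS Z₁ (Function.update st f .absent) ω q b) ∨
        (RdS Z₁ (Function.update st f .absent) ω a q ∧ RdS Z₁ (Function.update st f .absent) ω a₁ b) :=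
  RdS_double_iff_zq Z₁ a₁ hf ω hj hp a b

/-- With `p` in the double-component of `x`, the contraction of `f = pq` joins the blocks of `x` and `q` (blue). -/
theorem MgS_double_iff_xq {st : E₁ → EStat} {f : E₁} (hf : st f = .free) (ω : E₁ → Bool) {p q : V₁}
    (hj : Z₁.Joins f p q) (hp : p ∈ dblCompS Z₁ st a₁) (a b : V₁) :
    MgS Z₁ (Function.update st f .double) ω a b ↔
      MgS Z₁ (Function.update st f .absent) ω a b ∨
        (MgS Z₁ (Function.update st f .absent) ω a a₁ ∧ MgS Z₁ (Function.update st f .absent) ω q b) ∨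
        (MgS Z₁ (Function.update st f .absent) ω a q ∧ MgS Z₁ (Function.update st f .absent) ω a₁ b) :=
  MgS_double_iff_zq Z₁ a₁ hf ω hj hp a b

open Classical in
/-- The red four-mark pattern of the contraction is the `x`–`q` join of the deletion's. -/
theorem rsig6_double_xjoin6 {st : E₁ → EStat} {f : E₁} (hf : st f = .free) (ω : E₁ → Bool) {p q : V₁}
    (hj : Z₁.Joins f p q) (hp : p ∈ dblCompS Z₁ st a₁) :
    rsig6 Z₁ u u' q a₁ (Function.update st f .double) ω =
      xjoin6 (rsig6 Z₁ u u' q a₁ (Function.update st f .absent) ω) := by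
  have hxy := RdS_double_iff_xq Z₁ a₁ hf ω hj hp a₁ u
  have hxz := RdS_double_iff_xq Z₁ a₁ hf ω hj hp a₁ u'
  have hxq := RdS_double_iff_xq Z₁ a₁ hf ω hj hp a₁ q
  have hyz := RdS_double_iff_xq Z₁ a₁ hf ω hj hp u u'
  have hyq := RdS_double_iff_xq Z₁ a₁ hf ω hj hp u q
  have hzq := RdS_double_iff_xq Z₁ a₁ hf ω hj hp u' q
  have hr : RdS Z₁ (Function.update st f .absent) ω a₁ a₁ := RdS_refl' Z₁ _ ω a₁
  have hrq : RdS Z₁ (Function.update st f .absent) ω q q := RdS_refl' Z₁ _ ω q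
  rw [RdS_comm Z₁ _ ω q u] at hxy
  rw [RdS_comm Z₁ _ ω q u'] at hxz
  rw [RdS_comm Z₁ _ ω u a₁, RdS_comm Z₁ _ ω q u'] at hyz
  rw [RdS_comm Z₁ _ ω u a₁] at hyq
  rw [RdS_comm Z₁ _ ω u' a₁] at hzq
  simp only [rsig6, xjoin6, Prod.mk.injEq]
  refine ⟨?_, ?_, ?_, ?_, ?_, ?_⟩
  · by_cases hA : RdS Z₁ (Function.update st f .absent) ω a₁ u <;>
      by_cases hB : RdS Z₁ (Function.update st f .absent) ω a₁ q <;>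
      by_cases hC : RdS Z₁ (Function.update st f .absent) ω u q <;> simp [hxy, hA, hB, hC, hr]
  · by_cases hA : RdS Z₁ (Function.update st f .absent) ω a₁ u' <;>
      by_cases hB : RdS Z₁ (Function.update st f .absent) ω a₁ q <;>
      by_cases hC : RdS Z₁ (Function.update st f .absent) ω u' q <;> simp [hxz, hA, hB, hC, hr]
  · simp [hxq, hr, hrq]
  · by_cases hA : RdS Z₁ (Function.update st f .absent) ω u u' <;>
      by_cases hB : RdS Z₁ (Function.update st f .absent) ω a₁ u <;>
      by_cases hC : RdS Z₁ (Function.update st f .absent) ω u' q <;>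
      by_cases hD : RdS Z₁ (Function.update st f .absent) ω u q <;>
      by_cases hE : RdS Z₁ (Function.update st f .absent) ω a₁ u' <;> simp [hyz, hA, hB, hC, hD, hE]
  · by_cases hA : RdS Z₁ (Function.update st f .absent) ω u q <;>
      by_cases hB : RdS Z₁ (Function.update st f .absent) ω a₁ u <;> simp [hyq, hA, hB, hrq]
  · by_cases hA : RdS Z₁ (Function.update st f .absent) ω u' q <;>
      by_cases hB : RdS Z₁ (Function.update st f .absent) ω a₁ u' <;> simp [hzq, hA, hB, hrq]

open Classical in
/-- The blue four-mark pattern of the contraction is the `x`–`q` join of the deletion's. -/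
theorem bsig6_double_xjoin6 {st : E₁ → EStat} {f : E₁} (hf : st f = .free) (ω : E₁ → Bool) {p q : V₁}
    (hj : Z₁.Joins f p q) (hp : p ∈ dblCompS Z₁ st a₁) :
    bsig6 Z₁ u u' q a₁ (Function.update st f .double) ω =
      xjoin6 (bsig6 Z₁ u u' q a₁ (Function.update st f .absent) ω) := by
  have hxy := MgS_double_iff_xq Z₁ a₁ hf ω hj hp a₁ u
  have hxz := MgS_double_iff_xq Z₁ a₁ hf ω hj hp a₁ u'
  have hxq := MgS_double_iff_xq Z₁ a₁ hf ω hj hp a₁ q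
  have hyz := MgS_double_iff_xq Z₁ a₁ hf ω hj hp u u'
  have hyq := MgS_double_iff_xq Z₁ a₁ hf ω hj hp u q
  have hzq := MgS_double_iff_xq Z₁ a₁ hf ω hj hp u' q
  have hr : MgS Z₁ (Function.update st f .absent) ω a₁ a₁ := MgS_refl' Z₁ _ ω a₁
  have hrq : MgS Z₁ (Function.update st f .absent) ω q q := MgS_refl' Z₁ _ ω q
  rw [MgS_comm Z₁ _ ω q u] at hxy
  rw [MgS_comm Z₁ _ ω q u'] at hxz
  rw [MgS_comm Z₁ _ ω u a₁, MgS_comm Z₁ _ ω q u'] at hyz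
  rw [MgS_comm Z₁ _ ω u a₁] at hyq
  rw [MgS_comm Z₁ _ ω u' a₁] at hzq
  simp only [bsig6, xjoin6, Prod.mk.injEq]
  refine ⟨?_, ?_, ?_, ?_, ?_, ?_⟩
  · by_cases hA : MgS Z₁ (Function.update st f .absent) ω a₁ u <;>
      by_cases hB : MgS Z₁ (Function.update st f .absent) ω a₁ q <;>
      by_cases hC : MgS Z₁ (Function.update st f .absent) ω u q <;> simp [hxy, hA, hB, hC, hr]
  · by_cases hA : MgS Z₁ (Function.update st f .absent) ω a₁ u' <;>
      by_cases hB : MgS Z₁ (Function.update st f .absent) ω a₁ q <;>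
      by_cases hC : MgS Z₁ (Function.update st f .absent) ω u' q <;> simp [hxz, hA, hB, hC, hr]
  · simp [hxq, hr, hrq]
  · by_cases hA : MgS Z₁ (Function.update st f .absent) ω u u' <;>
      by_cases hB : MgS Z₁ (Function.update st f .absent) ω a₁ u <;>
      by_cases hC : MgS Z₁ (Function.update st f .absent) ω u' q <;>
      by_cases hD : MgS Z₁ (Function.update st f .absent) ω u q <;>
      by_cases hE : MgS Z₁ (Function.update st f .absent) ω a₁ u' <;> simp [hyz, hA, hB, hC, hD, hE]
  · by_cases hA : MgS Z₁ (Function.update st f .absent) ω u q <;>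
      by_cases hB : MgS Z₁ (Function.update st f .absent) ω a₁ u <;> simp [hyq, hA, hB, hrq]
  · by_cases hA : MgS Z₁ (Function.update st f .absent) ω u' q <;>
      by_cases hB : MgS Z₁ (Function.update st f .absent) ω a₁ u' <;> simp [hzq, hA, hB, hrq]

open Classical in
/-- The red three-mark pattern of the contraction is the `x`–`q` join of the deletion's four-mark pattern. -/
theorem rsig_double_xjoin3 {st : E₁ → EStat} {f : E₁} (hf : st f = .free) (ω : E₁ → Bool) {p q : V₁}
    (hj : Z₁.Joins f p q) (hp : p ∈ dblCompS Z₁ st a₁) :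
    rsig Z₁ u u' a₁ (Function.update st f .double) ω =
      xjoin3 (rsig6 Z₁ u u' q a₁ (Function.update st f .absent) ω) := by
  rw [rsig_eq_proj3 Z₁ u u' a₁ (Function.update st f .double) ω q, rsig6_double_xjoin6 Z₁ u u' a₁ hf ω hj hp,
    proj3_xjoin6]

open Classical in
/-- The blue three-mark pattern of the contraction is the `x`–`q` join of the deletion's four-mark pattern. -/
theorem bsig_double_xjoin3 {st : E₁ → EStat} {f : E₁} (hf : st f = .free) (ω : E₁ → Bool) {p q : V₁}
    (hj : Z₁.Joins f p q) (hp : p ∈ dblCompS Z₁ st a₁) :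
    bsig Z₁ u u' a₁ (Function.update st f .double) ω =
      xjoin3 (bsig6 Z₁ u u' q a₁ (Function.update st f .absent) ω) := by
  rw [bsig_eq_proj3 Z₁ u u' a₁ (Function.update st f .double) ω q, bsig6_double_xjoin6 Z₁ u u' a₁ hf ω hj hp,
    proj3_xjoin6]

end MultiExit

end ZoneZ

end PercRepro
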